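import Summits.HubbardSuperconductivity.HubbardSuperconductivity.Theorems.AposterioriCapRgSsbToEvenTorusLroLowManifoldTransfer
import Summits.HubbardSuperconductivity.HubbardSuperconductivity.Theorems.AposterioriCapRgSsbToEvenTorusLroLadderInductionStep
import Summits.HubbardSuperconductivity.HubbardSuperconductivity.Theses.AposterioriCapRg
import HarnessLib

/-!
# Route `AposterioriCapRg` — crux `SsbToEvenTorusLro` (stmt-HubbardSuperconductivity-1315),
# line `floating-mu-two-sided-pair-transfer`: the SHARPEST DISSECTION — rigidity at the summit's own sector

The ladder of the line walks a bright seed from a nearby sector to the summit's sector `N_L`; but the crux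
itself supplies a seed IN the sector `N_L` (a ground state: excess `0`), so modulo RIGIDITY AT THE SUMMIT'S
SECTOR ALONE (`PᴴP` nearly scalar on the low manifold `V_{N_L}(A/L)`, the `m = N_L` instance of the line's
`stub_lowManifoldRigidity`) the crux is EQUIVALENT to the existence of ONE bright (`⟨PᴴP⟩ ≥ bL⁴`), low-excess
(`≤ E₁/L`) unit vector in the summit's sector — no rung, no window convexity:

* `sss_seed_of_hasDWavePairFieldLROAt` — summit matrix at `(U, δ)` ⇒ the summit-sector seed (a ground state);
* `sss_hasDWavePairFieldLROAt_of_seed` — summit-sector rigidity ∧ seed ⇒ the summit matrix (ONE application of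
  the landed TRANSFER `stub_lowManifoldTransfer` with `θ₀ = E₁'/L`, `τ = A/L`, `A = 8KE₁'/b + 2E₁'`, then the
  landed floor kernel `hasDWavePairFieldLROAt_of_floor`);
* `sss_hasDWavePairFieldLROAt_iff_seed` — the pointwise equivalence;
* `SsbToEvenTorusLro_iff_summitSectorSeed` — the crux BY NAME: under summit-sector rigidity (filed under the crux
  antecedents) `SsbToEvenTorusLro ↔` the summit-sector seed (registered stub).

Reading for the planner: the every-ground-state content of the crux that this line isolates is the rigidity of the
pair intensity on the `O(1/L)`-low manifold of the summit's sector; the order input it needs is a bright vector of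
excess `O(1/L)` in that sector — two orders below the `O(hL²)` excess that sourced grand-canonical ground vectors
deliver after number projection (line number-projected-canonical-slope). Bookkeeping over landed lemmas; no
definition and no named fact is introduced. Source of the tower-of-states picture: T. Koma, H. Tasaki, J. Stat.
Phys. 76 (1994) 745, §2. All statements folklore.
-/

noncomputable section

namespace Summit.HubbardSuperconductivity.HubbardSuperconductivity.Theorems

-- summit = problem name (single-conjunct summit), D-0017
set_option linter.dupNamespace false

open Literature.MathematicalPhysics.QuantumLattice Literature.Probability.LatticeModels
open Literature.Barriers.HubbardSuperconductivity (HasDWavePairFieldLROAt)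
open Filter Set Matrix
open scoped ComplexOrder ComplexConjugate
open Summit.HubbardSuperconductivity.HubbardSuperconductivity.Theses.AposterioriCapRg (SsbToEvenTorusLro)
open Summit.HubbardSuperconductivity.WcbcsSsbToTorusLRO.Negative (hasDWavePairFieldLROAt_of_floor
  floor_of_hasDWavePairFieldLROAt exists_unit_groundStateInSector halfFilling_floor_le_sq)

/-- **Summit matrix ⇒ summit-sector seed**: a normalised ground state of the sector `N_L` is bright eventually
(`floor_of_hasDWavePairFieldLROAt`) and has excess `0`. [folklore] -/
theorem sss_seed_of_hasDWavePairFieldLROAt {U δ : ℝ} (hδ : 0 ≤ δ) (h : HasDWavePairFieldLROAt U δ) :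
    (∃ b E₁ : ℝ, 0 < b ∧ ∃ L₀ : ℕ, ∀ (L : ℕ) [NeZero L], L₀ ≤ L → Even L → ∃ φ : Fock (Orb (FermionTorus 2 L)), φ ∈ szSector (2 * ⌊(1 - δ) * (L : ℝ) ^ 2 / 2⌋₊) 0 ∧ star φ ⬝ᵥ φ = 1 ∧ (expect (hubbardTorus 2 L 1 U) φ).re ≤ (hubbardTorus 2 L 1 U).minEnergyOn (szSector (2 * ⌊(1 - δ) * (L : ℝ) ^ 2 / 2⌋₊) 0) + E₁ / (L : ℝ) ∧ b * (L : ℝ) ^ 4 ≤ (expect ((pairField dWaveFormFactor L)ᴴ * pairField dWaveFormFactor L) φ).re) := by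
  obtain ⟨a, ha, hev⟩ := floor_of_hasDWavePairFieldLROAt hδ h
  obtain ⟨K₀, hK₀⟩ := eventually_atTop.1 hev
  refine ⟨a, 0, ha, 2 * K₀ + 1 + 1, ?_⟩
  intro L _ hL hLe
  obtain ⟨k, rfl⟩ : ∃ k, L = 2 * k + 1 + 1 := by
    obtain ⟨r, hr⟩ := hLe
    exact ⟨r - 1, by omega⟩
  have hk : K₀ ≤ k := by omega
  obtain ⟨φ, hφ1, hφ⟩ := exists_unit_groundStateInSector (2 * k + 1 + 1) U
    (n := ⌊(1 - δ) * (((2 * k + 1 + 1 : ℕ)) : ℝ) ^ 2 / 2⌋₊) (halfFilling_floor_le_sq (2 * k + 1 + 1) hδ)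
  refine ⟨φ, hφ.1, hφ1, ?_, hK₀ k hk φ hφ hφ1⟩
  rw [zero_div, add_zero]
  have : expect (hubbardTorus 2 (2 * k + 1 + 1) 1 U) φ =
      (((hubbardTorus 2 (2 * k + 1 + 1) 1 U).minEnergyOn
        (szSector (2 * ⌊(1 - δ) * (((2 * k + 1 + 1 : ℕ)) : ℝ) ^ 2 / 2⌋₊) 0) : ℝ) : ℂ) := by
    rw [expect, hφ.2.2, dotProduct_smul, hφ1, smul_eq_mul, mul_one]
  rw [this, Complex.ofReal_re]

/-- **Summit-sector rigidity ∧ seed ⇒ summit matrix**: one TRANSFER at the sector `N_L` (`θ₀ = E₁'/L`,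
`τ = A/L`, `A = 8KE₁'/b + 2E₁'`, `E₁' = max E₁ 1`, `ρ = |C|/L`) makes every ground state of the sector bright
(`≥ bL⁴ − 4|C|L³ − (b/8)L⁴ ≥ bL⁴/2` once `L ≥ 32|C|/b`), and the floor kernel concludes. [folklore] -/
theorem sss_hasDWavePairFieldLROAt_of_seed {U δ : ℝ} (hR : (∀ A : ℝ, 0 < A → ∃ (C : ℝ) (L₀ : ℕ), ∀ (L : ℕ) [NeZero L], L₀ ≤ L → Even L → ∃ lam : ℝ, ∀ v ∈ Submodule.span ℂ {φ : Fock (Orb (FermionTorus 2 L)) | φ ∈ szSector (2 * ⌊(1 - δ) * (L : ℝ) ^ 2 / 2⌋₊) 0 ∧ ∃ E : ℝ, hubbardTorus 2 L 1 U *ᵥ φ = (E : ℂ) • φ ∧ E ≤ (hubbardTorus 2 L 1 U).minEnergyOn (szSector (2 * ⌊(1 - δ) * (L : ℝ) ^ 2 / 2⌋₊) 0) + A / (L : ℝ)}, (star (((pairField dWaveFormFactor L)ᴴ * pairField dWaveFormFactor L) *ᵥ v - ((lam * (L : ℝ) ^ 4 : ℝ) : ℂ) • v) ⬝ᵥ (((pairField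 dWaveFormFactor L)ᴴ * pairField dWaveFormFactor L) *ᵥ v - ((lam * (L : ℝ) ^ 4 : ℝ) : ℂ) • v)).re ≤ (C / (L : ℝ)) ^ 2 * (L : ℝ) ^ 8 * (star v ⬝ᵥ v).re)) (hS : (∃ b E₁ : ℝ, 0 < b ∧ ∃ L₀ : ℕ, ∀ (L : ℕ) [NeZero L], L₀ ≤ L → Even L → ∃ φ : Fock (Orb (FermionTorus 2 L)), φ ∈ szSector (2 * ⌊(1 - δ) * (L : ℝ) ^ 2 / 2⌋₊) 0 ∧ star φ ⬝ᵥ φ = 1 ∧ (expect (hubbardTorus 2 L 1 U) φ).re ≤ (hubbardTorus 2 L 1 U).minEnergyOn (szSector (2 * ⌊(1 - δ) * (L : ℝ) ^ 2 / 2⌋₊) 0) + E₁ / (L : ℝ) ∧ b * (L : ℝ) ^ 4 ≤ (expect ((pairField dWaveFormFactor L)ᴴ * pairField dWaveFormFactor L) φ).re)) : HasDWavePairFieldLROAt U δ := by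
  obtain ⟨K, hK, hT⟩ := stub_lowManifoldTransfer
  obtain ⟨b, E₁, hb, L₀, hseed⟩ := hS
  set E₁' : ℝ := max E₁ 1 with hE₁'
  have hE₁'0 : 0 < E₁' := lt_max_of_lt_right one_pos
  have hE₁E : E₁ ≤ E₁' := le_max_left _ _
  set A : ℝ := 8 * K * E₁' / b + 2 * E₁' with hAdef
  have hKE : 0 ≤ 8 * K * E₁' / b := by positivity
  have hA0 : 0 < A := by positivity
  have hA2 : 2 * E₁' ≤ A := by linarith only [hKE]
  have hA8 : K * E₁' / A ≤ b / 8 := by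
    rw [div_le_iff₀ hA0]
    have : b * A = 8 * K * E₁' + 2 * E₁' * b := by rw [hAdef]; field_simp
    nlinarith only [this, hE₁'0, hb]
  obtain ⟨C, L₁, hrig⟩ := hR A hA0
  set Lstar : ℕ := max (max L₀ L₁) ⌈32 * |C| / b + 1⌉₊ with hLstar
  have main : ∀ L : ℕ, Lstar ≤ L → ∀ [NeZero L], Even L →
      ∀ ψ : Fock (Orb (FermionTorus 2 L)),
        IsGroundStateInSector (hubbardTorus 2 L 1 U) (2 * ⌊(1 - δ) * (L : ℝ) ^ 2 / 2⌋₊) 0 ψ →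
        star ψ ⬝ᵥ ψ = 1 →
        b / 2 * (L : ℝ) ^ 4 ≤ (expect ((pairField dWaveFormFactor L)ᴴ * pairField dWaveFormFactor L) ψ).re := by
    intro L hL _ hLe ψ hψ hψ1
    have hL₀L : L₀ ≤ L := ((le_max_left _ _).trans (le_max_left _ _)).trans hL
    have hL₁L : L₁ ≤ L := ((le_max_right _ _).trans (le_max_left _ _)).trans hL
    have hCL : 32 * |C| / b + 1 ≤ (L : ℝ) := by
      have h1 : ⌈32 * |C| / b + 1⌉₊ ≤ L := (le_max_right _ _).trans hL
      have h2 : (⌈32 * |C| / b + 1⌉₊ : ℝ) ≤ L := by exact_mod_cast h1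
      exact (Nat.le_ceil _).trans h2
    have hC0 : 0 ≤ 32 * |C| / b := by positivity
    have hL1 : (1 : ℝ) ≤ L := by linarith only [hCL, hC0]
    have hLpos : (0 : ℝ) < L := by linarith only [hL1]
    obtain ⟨φ, hφS, hφ1, hφE, hφB⟩ := hseed L hL₀L hLe
    obtain ⟨lam, hlam⟩ := hrig L hL₁L hLe
    have hθτ₀ : 2 * (E₁' / (L : ℝ)) ≤ A / (L : ℝ) := by
      rw [← mul_div_assoc]; exact div_le_div_of_nonneg_right hA2 hLpos.le
    have hφE' : (expect (hubbardTorus 2 L 1 U) φ).re ≤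
        (hubbardTorus 2 L 1 U).minEnergyOn (szSector (2 * ⌊(1 - δ) * (L : ℝ) ^ 2 / 2⌋₊) 0) + E₁' / (L : ℝ) := by
      have : E₁ / (L : ℝ) ≤ E₁' / (L : ℝ) := div_le_div_of_nonneg_right hE₁E hLpos.le
      linarith only [hφE, this]
    have hrig' : ∀ v ∈ Submodule.span ℂ {φ : Fock (Orb (FermionTorus 2 L)) |
        φ ∈ szSector (2 * ⌊(1 - δ) * (L : ℝ) ^ 2 / 2⌋₊) 0 ∧ ∃ E : ℝ, hubbardTorus 2 L 1 U *ᵥ φ = (E : ℂ) • φ ∧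
          E ≤ (hubbardTorus 2 L 1 U).minEnergyOn (szSector (2 * ⌊(1 - δ) * (L : ℝ) ^ 2 / 2⌋₊) 0) + A / (L : ℝ)},
        (star (((pairField dWaveFormFactor L)ᴴ * pairField dWaveFormFactor L) *ᵥ v - ((lam * (L : ℝ) ^ 4 : ℝ) : ℂ) • v) ⬝ᵥ
          (((pairField dWaveFormFactor L)ᴴ * pairField dWaveFormFactor L) *ᵥ v - ((lam * (L : ℝ) ^ 4 : ℝ) : ℂ) • v)).re ≤
          (|C| / (L : ℝ)) ^ 2 * (L : ℝ) ^ 8 * (star v ⬝ᵥ v).re := by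
      intro v hv
      have e : (|C| / (L : ℝ)) ^ 2 = (C / (L : ℝ)) ^ 2 := by rw [div_pow, div_pow, sq_abs]
      rw [e]; exact hlam v hv
    have key := hT U L (2 * ⌊(1 - δ) * (L : ℝ) ^ 2 / 2⌋₊) (A / (L : ℝ)) (|C| / (L : ℝ)) (E₁' / (L : ℝ))
      (b * (L : ℝ) ^ 4) lam (div_pos hA0 hLpos) (by positivity) (by positivity) hθτ₀ hrig' φ hφS hφ1 hφE' hφB ψ
      (lis_groundState_mem_lowManifold (div_pos hA0 hLpos).le hψ) hψ1
    -- arithmetic: `4(|C|/L)L⁴ = 4|C|L³ ≤ (b/8)L⁴` and `K(E₁'/A)L⁴ ≤ (b/8)L⁴`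
    have e1 : 4 * (|C| / (L : ℝ)) * (L : ℝ) ^ 4 = 4 * |C| * (L : ℝ) ^ 3 := by
      field_simp
    have e2 : K * (E₁' / (L : ℝ) / (A / (L : ℝ))) * (L : ℝ) ^ 4 = K * E₁' / A * (L : ℝ) ^ 4 := by
      field_simp
    have h1 : 4 * |C| * (L : ℝ) ^ 3 ≤ b / 8 * (L : ℝ) ^ 4 := by
      have : 32 * |C| ≤ b * L := by
        have := (div_le_iff₀ hb).1 (show 32 * |C| / b ≤ (L : ℝ) by linarith only [hCL])
        linarith only [this]
      nlinarith only [this, pow_nonneg hLpos.le 3]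
    have h2 : K * E₁' / A * (L : ℝ) ^ 4 ≤ b / 8 * (L : ℝ) ^ 4 := mul_le_mul_of_nonneg_right hA8 (by positivity)
    rw [e1, e2] at key
    nlinarith only [key, h1, h2, pow_nonneg hLpos.le 4, hb]
  refine hasDWavePairFieldLROAt_of_floor ⟨b / 2, by positivity, ?_⟩
  exact eventually_atTop.2 ⟨Lstar, fun k hk ψ hψ hψ1 => main (2 * k + 1 + 1) (by omega) ⟨k + 1, by ring⟩ ψ hψ hψ1⟩

/-- **Pointwise equivalence**: under summit-sector rigidity (and `δ ≥ 0`), the summit matrix at `(U, δ)` holds iff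
the summit's sector carries one bright low-excess unit vector for all large even `L`. [folklore] -/
theorem sss_hasDWavePairFieldLROAt_iff_seed {U δ : ℝ} (hδ : 0 ≤ δ) (hR : (∀ A : ℝ, 0 < A → ∃ (C : ℝ) (L₀ : ℕ), ∀ (L : ℕ) [NeZero L], L₀ ≤ L → Even L → ∃ lam : ℝ, ∀ v ∈ Submodule.span ℂ {φ : Fock (Orb (FermionTorus 2 L)) | φ ∈ szSector (2 * ⌊(1 - δ) * (L : ℝ) ^ 2 / 2⌋₊) 0 ∧ ∃ E : ℝ, hubbardTorus 2 L 1 U *ᵥ φ = (E : ℂ) • φ ∧ E ≤ (hubbardTorus 2 L 1 U).minEnergyOn (szSector (2 * ⌊(1 - δ) * (L : ℝ) ^ 2 / 2⌋₊) 0) + A / (L : ℝ)}, (star (((pairField dWaveFormFactor L)ᴴ * pairField dWaveFormFactor L) *ᵥ v - ((lam * (L : ℝ) ^ 4 : ℝ) : ℂ) • v) ⬝ᵥ (((pairField dWaveFormFactor L)ᴴ * pairField dWaveFormFactor L) *ᵥ v - ((lam * (L : ℝ) ^ 4 : ℝ) : ℂ) • v)).re ≤ (C / (L : ℝ)) ^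 2 * (L : ℝ) ^ 8 * (star v ⬝ᵥ v).re)) :
    HasDWavePairFieldLROAt U δ ↔ (∃ b E₁ : ℝ, 0 < b ∧ ∃ L₀ : ℕ, ∀ (L : ℕ) [NeZero L], L₀ ≤ L → Even L → ∃ φ : Fock (Orb (FermionTorus 2 L)), φ ∈ szSector (2 * ⌊(1 - δ) * (L : ℝ) ^ 2 / 2⌋₊) 0 ∧ star φ ⬝ᵥ φ = 1 ∧ (expect (hubbardTorus 2 L 1 U) φ).re ≤ (hubbardTorus 2 L 1 U).minEnergyOn (szSector (2 * ⌊(1 - δ) * (L : ℝ) ^ 2 / 2⌋₊) 0) + E₁ / (L : ℝ) ∧ b * (L : ℝ) ^ 4 ≤ (expect ((pairField dWaveFormFactor L)ᴴ * pairField dWaveFormFactor L) φ).re) :=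
  ⟨sss_seed_of_hasDWavePairFieldLROAt hδ, sss_hasDWavePairFieldLROAt_of_seed hR⟩

/-- **The crux BY NAME, dissected** (registered `SsbToEvenTorusLro_iff_summitSectorSeed`): if, under the crux
antecedents, `PᴴP` is rigid on the `O(1/L)`-low manifold of the summit's own sector (the `m = N_L` instance of the
line's RIGIDITY), then `SsbToEvenTorusLro` is EQUIVALENT to: under the same antecedents, ONE bright (`≥ bL⁴`)
unit vector of excess `≤ E₁/L` in the summit's sector, for all large even `L`. [folklore] -/
theorem SsbToEvenTorusLro_iff_summitSectorSeed :
    (∀ (U δ μ : ℝ), 0 < U → δ ∈ Set.Ioo (0:ℝ) 1 → Filter.Tendsto (fun L : ℕ => ((hubbardTorusWith 2 (L + 1) 1 U μ).groundStateFunctional totalNumber).re / ((L + 1 : ℕ) : ℝ) ^ 2) Filter.atTop (nhds (1 - δ)) → HasDWaveOrder U μ → ∀ A : ℝ, 0 < A → ∃ (C : ℝ) (L₀ : ℕ), ∀ (L : ℕ) [NeZero L], L₀ ≤ L → Even L → ∃ lam : ℝ, ∀ v ∈ Submodule.span ℂ {φ : Fock (Orb (FermionTorus 2 L)) | φ ∈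 szSector (2 * ⌊(1 - δ) * (L : ℝ) ^ 2 / 2⌋₊) 0 ∧ ∃ E : ℝ, hubbardTorus 2 L 1 U *ᵥ φ = (E : ℂ) • φ ∧ E ≤ (hubbardTorus 2 L 1 U).minEnergyOn (szSector (2 * ⌊(1 - δ) * (L : ℝ) ^ 2 / 2⌋₊) 0) + A / (L : ℝ)}, (star (((pairField dWaveFormFactor L)ᴴ * pairField dWaveFormFactor L) *ᵥ v - ((lam * (L : ℝ) ^ 4 : ℝ) : ℂ) • v) ⬝ᵥ (((pairField dWaveFormFactor L)ᴴ * pairField dWaveFormFactor L) *ᵥ v - ((lam * (L : ℝ) ^ 4 : ℝ) : ℂ) • v)).re ≤ (C / (L : ℝ)) ^ 2 * (L : ℝ) ^ 8 * (star v ⬝ᵥ v).re) → (SsbToEvenTorusLro ↔ ∀ (U δ μ : ℝ), 0 < U → δ ∈ Set.Ioo (0:ℝ) 1 → Filter.Tendsto (fun L : ℕ => ((hubbardTorusWith 2 (L + 1) 1 U μ).groundStateFunctional totalNumber).re / ((L + 1 : ℕ) : ℝ) ^ 2) Filter.atTop (nhds (1 - δ)) → HasDWaveOrder U μ → ∃ b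 E₁ : ℝ, 0 < b ∧ ∃ L₀ : ℕ, ∀ (L : ℕ) [NeZero L], L₀ ≤ L → Even L → ∃ φ : Fock (Orb (FermionTorus 2 L)), φ ∈ szSector (2 * ⌊(1 - δ) * (L : ℝ) ^ 2 / 2⌋₊) 0 ∧ star φ ⬝ᵥ φ = 1 ∧ (expect (hubbardTorus 2 L 1 U) φ).re ≤ (hubbardTorus 2 L 1 U).minEnergyOn (szSector (2 * ⌊(1 - δ) * (L : ℝ) ^ 2 / 2⌋₊) 0) + E₁ / (L : ℝ) ∧ b * (L : ℝ) ^ 4 ≤ (expect ((pairField dWaveFormFactor L)ᴴ * pairField dWaveFormFactor L) φ).re) := by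
  intro hR
  constructor
  · intro h U δ μ hU hδ hD hO
    exact sss_seed_of_hasDWavePairFieldLROAt hδ.1.le (h U δ μ hU hδ hD hO)
  · intro hS U δ μ hU hδ hD hO
    exact sss_hasDWavePairFieldLROAt_of_seed (hR U δ μ hU hδ hD hO) (hS U δ μ hU hδ hD hO)

/-! ## Appendix (lead c3, same session): VANISHING RELATIVE TOLERANCE suffices at the summit's sector

At the summit's own sector no rung is run, so the rigidity tolerance need not be `O(1/L)` relative (`CL³` absolute): ANY
relative tolerance `ϱ → 0` (absolute `o(L⁴)`) does, since one TRANSFER loses `4ϱL⁴`. This matters in `d = 2`: a Gaussian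
spin-wave estimate of `‖(PᴴP − λL⁴)ψ‖` for a ground state `ψ` with a linear Goldstone mode gives `L³ (log L)^{1/2}`
(the variance of `Σ_{k≠0} |θ̂_k|²` is `Σ_k ⟨|θ̂_k|²⟩² ~ Σ_k |k|⁻² ~ L² log L`), marginally ABOVE the line's typed tolerance
`CL³` but far inside `o(L⁴)`. So the robust form of the dissection is: -/

/-- **Summit-sector rigidity with vanishing relative tolerance ∧ seed ⇒ summit matrix**: as
`sss_hasDWavePairFieldLROAt_of_seed`, with the rigidity tolerance `ϱ²L⁸‖v‖²` for an arbitrary `ϱ > 0` eventually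
(used at `ϱ = b/64`): floor `bL⁴ − (b/16)L⁴ − (b/8)L⁴ ≥ bL⁴/2`. [folklore] -/
theorem sss_hasDWavePairFieldLROAt_of_seed_o1 {U δ : ℝ} (hR : (∀ A : ℝ, 0 < A → ∀ ϱ : ℝ, 0 < ϱ → ∃ L₀ : ℕ, ∀ (L : ℕ) [NeZero L], L₀ ≤ L → Even L → ∃ lam : ℝ, ∀ v ∈ Submodule.span ℂ {φ : Fock (Orb (FermionTorus 2 L)) | φ ∈ szSector (2 * ⌊(1 - δ) * (L : ℝ) ^ 2 / 2⌋₊) 0 ∧ ∃ E : ℝ, hubbardTorus 2 L 1 U *ᵥ φ = (E : ℂ) • φ ∧ E ≤ (hubbardTorus 2 L 1 U).minEnergyOn (szSector (2 * ⌊(1 - δ) * (L : ℝ) ^ 2 / 2⌋₊) 0) + A / (L : ℝ)}, (star (((pairField dWaveFormFactor L)ᴴ * pairField dWaveFormFactor L) *ᵥ v - ((lam * (L : ℝ) ^ 4 : ℝ) : ℂ) • v) ⬝ᵥ (((pairField dWaveFormFactor L)ᴴ * pairField dWaveFormFactor L) *ᵥ v - ((lam * (L : ℝ) ^ 4 : ℝ)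 : ℂ) • v)).re ≤ ϱ ^ 2 * (L : ℝ) ^ 8 * (star v ⬝ᵥ v).re)) (hS : (∃ b E₁ : ℝ, 0 < b ∧ ∃ L₀ : ℕ, ∀ (L : ℕ) [NeZero L], L₀ ≤ L → Even L → ∃ φ : Fock (Orb (FermionTorus 2 L)), φ ∈ szSector (2 * ⌊(1 - δ) * (L : ℝ) ^ 2 / 2⌋₊) 0 ∧ star φ ⬝ᵥ φ = 1 ∧ (expect (hubbardTorus 2 L 1 U) φ).re ≤ (hubbardTorus 2 L 1 U).minEnergyOn (szSector (2 * ⌊(1 - δ) * (L : ℝ) ^ 2 / 2⌋₊) 0) + E₁ / (L : ℝ) ∧ b * (L : ℝ) ^ 4 ≤ (expect ((pairField dWaveFormFactor L)ᴴ * pairField dWaveFormFactor L) φ).re)) : HasDWavePairFieldLROAt U δ := by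
  obtain ⟨K, hK, hT⟩ := stub_lowManifoldTransfer
  obtain ⟨b, E₁, hb, L₀, hseed⟩ := hS
  set E₁' : ℝ := max E₁ 1 with hE₁'
  have hE₁'0 : 0 < E₁' := lt_max_of_lt_right one_pos
  have hE₁E : E₁ ≤ E₁' := le_max_left _ _
  set A : ℝ := 8 * K * E₁' / b + 2 * E₁' with hAdef
  have hKE : 0 ≤ 8 * K * E₁' / b := by positivity
  have hA0 : 0 < A := by positivity
  have hA2 : 2 * E₁' ≤ A := by linarith only [hKE]
  have hA8 : K * E₁' / A ≤ b / 8 := by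
    rw [div_le_iff₀ hA0]
    have : b * A = 8 * K * E₁' + 2 * E₁' * b := by rw [hAdef]; field_simp
    nlinarith only [this, hE₁'0, hb]
  obtain ⟨L₁, hrig⟩ := hR A hA0 (b / 64) (by positivity)
  have main : ∀ L : ℕ, max L₀ L₁ ≤ L → ∀ [NeZero L], Even L →
      ∀ ψ : Fock (Orb (FermionTorus 2 L)),
        IsGroundStateInSector (hubbardTorus 2 L 1 U) (2 * ⌊(1 - δ) * (L : ℝ) ^ 2 / 2⌋₊) 0 ψ →
        star ψ ⬝ᵥ ψ = 1 →
        b / 2 * (L : ℝ) ^ 4 ≤ (expect ((pairField dWaveFormFactor L)ᴴ * pairField dWaveFormFactor L) ψ).re := by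
    intro L hL _ hLe ψ hψ hψ1
    have hL₀L : L₀ ≤ L := (le_max_left _ _).trans hL
    have hL₁L : L₁ ≤ L := (le_max_right _ _).trans hL
    have hLpos : (0 : ℝ) < L := by exact_mod_cast Nat.pos_of_ne_zero (NeZero.ne L)
    obtain ⟨φ, hφS, hφ1, hφE, hφB⟩ := hseed L hL₀L hLe
    obtain ⟨lam, hlam⟩ := hrig L hL₁L hLe
    have hθτ₀ : 2 * (E₁' / (L : ℝ)) ≤ A / (L : ℝ) := by
      rw [← mul_div_assoc]; exact div_le_div_of_nonneg_right hA2 hLpos.le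
    have hφE' : (expect (hubbardTorus 2 L 1 U) φ).re ≤
        (hubbardTorus 2 L 1 U).minEnergyOn (szSector (2 * ⌊(1 - δ) * (L : ℝ) ^ 2 / 2⌋₊) 0) + E₁' / (L : ℝ) := by
      have : E₁ / (L : ℝ) ≤ E₁' / (L : ℝ) := div_le_div_of_nonneg_right hE₁E hLpos.le
      linarith only [hφE, this]
    have key := hT U L (2 * ⌊(1 - δ) * (L : ℝ) ^ 2 / 2⌋₊) (A / (L : ℝ)) (b / 64) (E₁' / (L : ℝ))
      (b * (L : ℝ) ^ 4) lam (div_pos hA0 hLpos) (by positivity) (by positivity) hθτ₀ hlam φ hφS hφ1 hφE' hφB ψ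
      (lis_groundState_mem_lowManifold (div_pos hA0 hLpos).le hψ) hψ1
    have e2 : K * (E₁' / (L : ℝ) / (A / (L : ℝ))) * (L : ℝ) ^ 4 = K * E₁' / A * (L : ℝ) ^ 4 := by
      field_simp
    have h2 : K * E₁' / A * (L : ℝ) ^ 4 ≤ b / 8 * (L : ℝ) ^ 4 := mul_le_mul_of_nonneg_right hA8 (by positivity)
    rw [e2] at key
    nlinarith only [key, h2, pow_nonneg hLpos.le 4, hb]
  refine hasDWavePairFieldLROAt_of_floor ⟨b / 2, by positivity, ?_⟩
  exact eventually_atTop.2 ⟨max L₀ L₁, fun k hk ψ hψ hψ1 => main (2 * k + 1 + 1) (by omega) ⟨k + 1, by ring⟩ ψ hψ hψ1⟩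

/-- **Pointwise equivalence, robust form**: under summit-sector rigidity with vanishing relative tolerance (and
`δ ≥ 0`), the summit matrix at `(U, δ)` holds iff the summit's sector carries one bright low-excess unit vector for all
large even `L`. [folklore] -/
theorem sss_hasDWavePairFieldLROAt_iff_seed_o1 {U δ : ℝ} (hδ : 0 ≤ δ) (hR : (∀ A : ℝ, 0 < A → ∀ ϱ : ℝ, 0 < ϱ → ∃ L₀ : ℕ, ∀ (L : ℕ) [NeZero L], L₀ ≤ L → Even L → ∃ lam : ℝ, ∀ v ∈ Submodule.span ℂ {φ : Fock (Orb (FermionTorus 2 L)) | φ ∈ szSector (2 * ⌊(1 - δ) * (L : ℝ) ^ 2 / 2⌋₊) 0 ∧ ∃ E : ℝ, hubbardTorus 2 L 1 U *ᵥ φ = (E : ℂ) • φ ∧ E ≤ (hubbardTorus 2 L 1 U).minEnergyOn (szSector (2 * ⌊(1 - δ) * (L : ℝ) ^ 2 / 2⌋₊) 0) + A / (L : ℝ)}, (star (((pairField dWaveFormFactor L)ᴴ * pairField dWaveFormFactor L) *ᵥ v - ((lam * (L : ℝ) ^ 4 : ℝ) : ℂ) • v) ⬝ᵥ (((pairField dWaveFormFactor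 L)ᴴ * pairField dWaveFormFactor L) *ᵥ v - ((lam * (L : ℝ) ^ 4 : ℝ) : ℂ) • v)).re ≤ ϱ ^ 2 * (L : ℝ) ^ 8 * (star v ⬝ᵥ v).re)) :
    HasDWavePairFieldLROAt U δ ↔ (∃ b E₁ : ℝ, 0 < b ∧ ∃ L₀ : ℕ, ∀ (L : ℕ) [NeZero L], L₀ ≤ L → Even L → ∃ φ : Fock (Orb (FermionTorus 2 L)), φ ∈ szSector (2 * ⌊(1 - δ) * (L : ℝ) ^ 2 / 2⌋₊) 0 ∧ star φ ⬝ᵥ φ = 1 ∧ (expect (hubbardTorus 2 L 1 U) φ).re ≤ (hubbardTorus 2 L 1 U).minEnergyOn (szSector (2 * ⌊(1 - δ) * (L : ℝ) ^ 2 / 2⌋₊) 0) + E₁ / (L : ℝ) ∧ b * (L : ℝ) ^ 4 ≤ (expect ((pairField dWaveFormFactor L)ᴴ * pairField dWaveFormFactor L) φ).re) :=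
  ⟨sss_seed_of_hasDWavePairFieldLROAt hδ, sss_hasDWavePairFieldLROAt_of_seed_o1 hR⟩

/-- **The crux BY NAME, dissected — robust form** (registered `SsbToEvenTorusLro_iff_summitSectorSeed_o1`): if, under
the crux antecedents, `PᴴP` is rigid on the `O(1/L)`-low manifold of the summit's own sector up to ANY vanishing relative
tolerance `ϱ → 0`, then `SsbToEvenTorusLro ↔` (under the same antecedents) ONE bright unit vector of excess `≤ E₁/L` in
the summit's sector for all large even `L`. [folklore] -/
theorem SsbToEvenTorusLro_iff_summitSectorSeed_o1 :
    (∀ (U δ μ : ℝ), 0 < U → δ ∈ Set.Ioo (0:ℝ) 1 → Filter.Tendsto (fun L : ℕ => ((hubbardTorusWith 2 (L + 1) 1 U μ).groundStateFunctional totalNumber).re / ((L + 1 : ℕ) : ℝ) ^ 2) Filter.atTop (nhds (1 - δ)) → HasDWaveOrder U μ → ∀ A : ℝ, 0 < A → ∀ ϱ : ℝ, 0 < ϱ → ∃ L₀ : ℕ, ∀ (L : ℕ) [NeZero L], L₀ ≤ L → Even L → ∃ lam : ℝ, ∀ v ∈ Submodule.span ℂ {φ : Fock (Orb (FermionTorus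 2 L)) | φ ∈ szSector (2 * ⌊(1 - δ) * (L : ℝ) ^ 2 / 2⌋₊) 0 ∧ ∃ E : ℝ, hubbardTorus 2 L 1 U *ᵥ φ = (E : ℂ) • φ ∧ E ≤ (hubbardTorus 2 L 1 U).minEnergyOn (szSector (2 * ⌊(1 - δ) * (L : ℝ) ^ 2 / 2⌋₊) 0) + A / (L : ℝ)}, (star (((pairField dWaveFormFactor L)ᴴ * pairField dWaveFormFactor L) *ᵥ v - ((lam * (L : ℝ) ^ 4 : ℝ) : ℂ) • v) ⬝ᵥ (((pairField dWaveFormFactor L)ᴴ * pairField dWaveFormFactor L) *ᵥ v - ((lam * (L : ℝ) ^ 4 : ℝ) : ℂ) • v)).re ≤ ϱ ^ 2 * (L : ℝ) ^ 8 * (star v ⬝ᵥ v).re) → (SsbToEvenTorusLro ↔ ∀ (U δ μ : ℝ), 0 < U → δ ∈ Set.Ioo (0:ℝ) 1 → Filter.Tendsto (fun L : ℕ => ((hubbardTorusWith 2 (L + 1) 1 U μ).groundStateFunctional totalNumber).re / ((L + 1 : ℕ) : ℝ) ^ 2) Filter.atTop (nhds (1 - δ)) → HasDWaveOrder U μ →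 ∃ b E₁ : ℝ, 0 < b ∧ ∃ L₀ : ℕ, ∀ (L : ℕ) [NeZero L], L₀ ≤ L → Even L → ∃ φ : Fock (Orb (FermionTorus 2 L)), φ ∈ szSector (2 * ⌊(1 - δ) * (L : ℝ) ^ 2 / 2⌋₊) 0 ∧ star φ ⬝ᵥ φ = 1 ∧ (expect (hubbardTorus 2 L 1 U) φ).re ≤ (hubbardTorus 2 L 1 U).minEnergyOn (szSector (2 * ⌊(1 - δ) * (L : ℝ) ^ 2 / 2⌋₊) 0) + E₁ / (L : ℝ) ∧ b * (L : ℝ) ^ 4 ≤ (expect ((pairField dWaveFormFactor L)ᴴ * pairField dWaveFormFactor L) φ).re) := by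
  intro hR
  constructor
  · intro h U δ μ hU hδ hD hO
    exact sss_seed_of_hasDWavePairFieldLROAt hδ.1.le (h U δ μ hU hδ hD hO)
  · intro hS U δ μ hU hδ hD hO
    exact sss_hasDWavePairFieldLROAt_of_seed_o1 (hR U δ μ hU hδ hD hO) (hS U δ μ hU hδ hD hO)

end Summit.HubbardSuperconductivity.HubbardSuperconductivity.Theorems

end
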